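import Summits.RiemannHypothesis.RiemannHypothesis.Theorems.MotivicDoor.AWS.ForcingUpApprox
import Mathlib.Analysis.Calculus.BumpFunction.InnerProduct

/-!
# AWS sprint, GENERATORS-UP (part 2): generating families exist — the monomial–bump family

HONEST LABEL (verbatim on every AWS file).  One-way implication from a strengthened,
prime-side-only axiom system; the existence of such an object is NOT claimed and is the located
gap; the converse (RH ⇒ existence) is out of scope and, for this axiom system, tautological
rather than informative (AXIOM-CONTENT.md §2; `riemannHypothesis_iff_exists_tautologicalCarrier`).
Framing: lottery ticket at the motivic door; RH probability
negligible; consolation prizes are real: a new semi-local Weil-positivity theorem, or a located gap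
in the Connes–Consani programme, plus the ff-door theorem.

## Content

The structure `ArithmeticWeilSurface` (`Theorems/MotivicDoorAWSStructure`) carries a field
`gen : GeneratingFamily` whose `dense` component is the FORCING (density) axiom: every real Weil
test function is, on a window `[-R, R]` containing its support, a `C¹`-uniform limit of rational
multiples `N⁻¹ u_c` of INTEGER combinations `u_c = Σ c_i φ_i` of the generators supported in the
same window.  If no `GeneratingFamily` existed, `ArithmeticWeilSurface` would be empty and the
sprint theorem `Nonempty ArithmeticWeilSurface → RiemannHypothesis` vacuous (REFEREE-1 P2: the
instance is a mandatory deliverable).  This file removes that possibility with two PROVED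
instances:

* `tautologicalFamily` — all real Weil tests as generators (density is trivial: `u = 1⁻¹ u_{δ_u}`);
  type-level non-vacuity.
* `monomialBumpFamily` — the EXPLICIT COUNTABLE family `φ_{(n,k)}(t) = t^k β_n(t)`,
  `(n, k) ∈ ℕ × ℕ`, with `β_n = windowBump n` Mathlib's smooth bump equal to `1` on
  `[-(n+1), n+1]` and supported in `[-(n+2), n+2]`.  Its density (`monomialBump_dense`) is the
  "generators-up" theorem of the sprint: for `supp u ⊆ [-n, n]` take the window `R = n + 2`,
  a rational polynomial `N⁻¹ P` `C¹`-close to `u` on `[-R, R]`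
  (`ForcingUp.exists_int_polynomial_C1_near`: Weierstrass + antiderivative + FTC +
  rationalisation), and the integer combination `c = Σ_k P_k δ_{(n,k)}` (`polyCombination`), for
  which `N⁻¹ u_c = (N⁻¹ P) · β_n`; since `β_n ≡ 1` near `supp u`, `|β_n| ≤ 1` and `|β_n'| ≤ C`,
  the `C¹`-distance on the window is `≤ η (1 + C)` and both sides vanish off the window.
  The finite truncation levels `{(n, k) : k ≤ K}` of this family are the levels of the carrier
  search (cell `pub-rhdoor`, AWS-DESIGN §4).
* `nonempty_generatingFamily : Nonempty GeneratingFamily`.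

What this does NOT show: that the remaining fields of `ArithmeticWeilSurface` (lattice, prime-side
pairing data, Hodge index) are jointly satisfiable for this or any family — that is the located
gap.  No zeros of `ζ`, no `RiemannHypothesis`, no Weil functional enter this file.
-/

noncomputable section

open Complex Set MeasureTheory Filter Polynomial Metric Literature.NumberTheory.LFunctions
open scoped Topology ContDiff Interval

namespace Summit.RiemannHypothesis.RiemannHypothesis.Theorems.MotivicDoor.AWS

/-! ## The tautological generating family -/

open ForcingUp in
/-- **Type-level non-vacuity of the forcing axiom**: the family of ALL real Weil test functions is
a generating family (each test function is its own integer combination, `N = 1`).  This shows that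
`GeneratingFamily` — hence the hypothesis type of the sprint theorem as far as the generating
family is concerned — is inhabited; the explicit countable family is `monomialBumpFamily` below. -/
def tautologicalFamily : GeneratingFamily where
  ι := {u : ℝ → ℝ // IsWeilTest fun t ↦ (u t : ℂ)}
  φ := fun i ↦ i.1
  isWeilTest := fun i ↦ i.2
  dense := by
    intro u hu
    obtain ⟨n, hn⟩ := exists_nat_tsupport_subset (hasCompactSupport_of_isWeilTest hu)
    have hsub : tsupport u ⊆ Icc (-((n : ℝ) + 1)) ((n : ℝ) + 1) :=
      hn.trans (Icc_subset_Icc (by linarith) (by linarith))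
    refine ⟨(n : ℝ) + 1, by positivity, hsub, fun ε hε ↦ ⟨1, Finsupp.single ⟨u, hu⟩ 1, one_pos, ?_⟩⟩
    have hc : testCombination (fun i : {u : ℝ → ℝ // IsWeilTest fun t ↦ (u t : ℂ)} ↦ i.1)
        (Finsupp.single ⟨u, hu⟩ 1) = u := testCombination_single _ _
    refine ⟨by rw [hc]; exact hsub, fun t ↦ ?_, fun t ↦ ?_⟩
    · simp [hc, hε.le]
    · simp [hc, hε.le]


/-! ## The monomial–bump family -/

/-- The window bump `β_n`: Mathlib's smooth bump function centred at `0`, equal to `1` on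
`[-(n+1), n+1]` and supported in `[-(n+2), n+2]`. -/
def windowBump (n : ℕ) : ContDiffBump (0 : ℝ) where
  rIn := n + 1
  rOut := n + 2
  rIn_pos := by positivity
  rIn_lt_rOut := by linarith

/-- The generators `φ_{(n,k)}(t) = t^k β_n(t)` of the monomial–bump family (`(n, k) ∈ ℕ × ℕ`:
window index and monomial degree). -/
def monomialBump (i : ℕ × ℕ) (t : ℝ) : ℝ := t ^ i.2 * windowBump i.1 t

/-- The integer combination of the window-`n` generators with coefficients read off an integer
polynomial `P = Σ P_k X^k`: `c = Σ_k P_k δ_{(n,k)}`, so that `u_c = P · β_n`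
(`testCombination_polyCombination`). -/
def polyCombination (n : ℕ) (P : ℤ[X]) : ℕ × ℕ →₀ ℤ :=
  ∑ k ∈ P.support, Finsupp.single (n, k) (P.coeff k)

namespace ForcingUp

/-- `β_n = 1` on `[-(n+1), n+1]`. -/
theorem windowBump_eq_one {n : ℕ} {t : ℝ} (ht : |t| ≤ n + 1) : windowBump n t = 1 :=
  (windowBump n).one_of_mem_closedBall (by rwa [mem_closedBall_zero_iff, Real.norm_eq_abs])

/-- `β_n' = 0` on `(-(n+1), n+1)`. -/
theorem deriv_windowBump_eq_zero_of_lt {n : ℕ} {t : ℝ} (ht : |t| < n + 1) :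
    deriv (windowBump n) t = 0 := by
  have h : (windowBump n : ℝ → ℝ) =ᶠ[𝓝 t] 1 :=
    (windowBump n).eventuallyEq_one_of_mem_ball (by rwa [mem_ball_zero_iff, Real.norm_eq_abs])
  rw [h.deriv_eq]
  exact deriv_const t 1

/-- `tsupport β_n = [-(n+2), n+2]`. -/
theorem tsupport_windowBump (n : ℕ) :
    tsupport (windowBump n) = Icc (-((n : ℝ) + 2)) ((n : ℝ) + 2) := by
  rw [(windowBump n).tsupport_eq, Real.closedBall_eq_Icc, zero_sub, zero_add]
  rfl

/-- Off `[-(n+2), n+2]` the bump vanishes identically near the point. -/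
theorem windowBump_eventuallyEq_zero {n : ℕ} {t : ℝ}
    (ht : t ∉ Icc (-((n : ℝ) + 2)) ((n : ℝ) + 2)) : (windowBump n : ℝ → ℝ) =ᶠ[𝓝 t] 0 := by
  rw [← tsupport_windowBump] at ht
  exact notMem_tsupport_iff_eventuallyEq.mp ht

/-- `β_n = 0` off `[-(n+2), n+2]`. -/
theorem windowBump_eq_zero {n : ℕ} {t : ℝ} (ht : t ∉ Icc (-((n : ℝ) + 2)) ((n : ℝ) + 2)) :
    windowBump n t = 0 :=
  (windowBump_eventuallyEq_zero ht).eq_of_nhds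

/-- `β_n' = 0` off `[-(n+2), n+2]`. -/
theorem deriv_windowBump_eq_zero_of_notMem {n : ℕ} {t : ℝ}
    (ht : t ∉ Icc (-((n : ℝ) + 2)) ((n : ℝ) + 2)) : deriv (windowBump n) t = 0 := by
  rw [(windowBump_eventuallyEq_zero ht).deriv_eq]
  exact deriv_const t 0

/-- `|β_n| ≤ 1`. -/
theorem abs_windowBump_le_one (n : ℕ) (t : ℝ) : |windowBump n t| ≤ 1 :=
  abs_le.mpr ⟨by linarith [(windowBump n).nonneg (x := t)], (windowBump n).le_one⟩

/-- `β_n` is differentiable. -/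
theorem differentiable_windowBump (n : ℕ) : Differentiable ℝ (windowBump n) :=
  ((windowBump n).contDiff (n := 1)).differentiable (by simp)

/-- `β_n'` is continuous. -/
theorem continuous_deriv_windowBump (n : ℕ) : Continuous (deriv (windowBump n)) :=
  ((windowBump n).contDiff (n := 1)).continuous_deriv (by simp)

/-- `β_n'` is bounded: `|β_n'| ≤ C` for some `C ≥ 0`. -/
theorem exists_bound_deriv_windowBump (n : ℕ) :
    ∃ C : ℝ, 0 ≤ C ∧ ∀ t, |deriv (windowBump n) t| ≤ C := by
  obtain ⟨C, hC⟩ := (windowBump n).hasCompactSupport.deriv.exists_bound_of_continuous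
    (continuous_deriv_windowBump n)
  refine ⟨C, (norm_nonneg _).trans (hC 0), fun t ↦ ?_⟩
  rw [← Real.norm_eq_abs]
  exact hC t

/-- The generators are smooth. -/
theorem contDiff_monomialBump (i : ℕ × ℕ) : ContDiff ℝ ∞ (monomialBump i) :=
  (contDiff_id.pow i.2).mul (windowBump i.1).contDiff

/-- The generators are compactly supported. -/
theorem hasCompactSupport_monomialBump (i : ℕ × ℕ) : HasCompactSupport (monomialBump i) :=
  (windowBump i.1).hasCompactSupport.mul_left

/-- The generators complexify to Weil test functions. -/
theorem isWeilTest_monomialBump (i : ℕ × ℕ) : IsWeilTest fun t ↦ (monomialBump i t : ℂ) :=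
  isWeilTest_ofReal (contDiff_monomialBump i) (hasCompactSupport_monomialBump i)

/-- `u_c = P · β_n` for `c = polyCombination n P`. -/
theorem testCombination_polyCombination (n : ℕ) (P : ℤ[X]) (t : ℝ) :
    testCombination monomialBump (polyCombination n P) t =
      (P.map (Int.castRingHom ℝ)).eval t * windowBump n t := by
  rw [polyCombination, testCombination_finset_sum, Finset.sum_apply]
  simp only [testCombination_single_apply]
  rw [eval_map, eval₂_eq_sum, Polynomial.sum_def, Finset.sum_mul]
  refine Finset.sum_congr rfl fun k _ ↦ ?_
  simp only [monomialBump, eq_intCast]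
  ring

/-- **Density of the monomial–bump family (GENERATORS-UP).**  Every real Weil test function `u`
is, on the window `[-(n+2), n+2]` (`supp u ⊆ [-n, n]`), a `C¹`-uniform limit of rational
multiples `N⁻¹ u_c` of integer combinations of the generators `t^k β_n(t)` supported in that
window: `N⁻¹ u_c = (N⁻¹ P) · β_n` with `N⁻¹ P` a rational polynomial `C¹`-close to `u` on the
window (`exists_int_polynomial_C1_near`), and `β_n ≡ 1` near `supp u`, `|β_n| ≤ 1`,
`|β_n'| ≤ C`. -/
theorem monomialBump_dense (u : ℝ → ℝ) (hu : IsWeilTest fun t ↦ (u t : ℂ)) :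
    ∃ R : ℝ, 0 < R ∧ tsupport u ⊆ Icc (-R) R ∧
      ∀ ε : ℝ, 0 < ε → ∃ (N : ℕ) (c : ℕ × ℕ →₀ ℤ), 0 < N ∧
        tsupport (testCombination monomialBump c) ⊆ Icc (-R) R ∧
        (∀ t, |u t - (N : ℝ)⁻¹ * testCombination monomialBump c t| ≤ ε) ∧
        (∀ t, |deriv u t - deriv (fun s ↦ (N : ℝ)⁻¹ * testCombination monomialBump c s) t|
          ≤ ε) := by
  have hus := contDiff_of_isWeilTest hu
  have huc := hasCompactSupport_of_isWeilTest hu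
  have hud : Differentiable ℝ u := hus.differentiable (by simp)
  have hudc : Continuous (deriv u) := hus.continuous_deriv (by simp)
  obtain ⟨n, hn⟩ := exists_nat_tsupport_subset huc
  set R : ℝ := (n : ℝ) + 2 with hR
  have hRpos : 0 < R := by positivity
  have hsub : tsupport u ⊆ Icc (-R) R := hn.trans (Icc_subset_Icc (by linarith) (by linarith))
  have hu_zero : ∀ t, t ∉ tsupport u → u t = 0 := fun t ht ↦ image_eq_zero_of_notMem_tsupport ht
  have hdu_zero : ∀ t, t ∉ tsupport u → deriv u t = 0 := fun t ht ↦
    Function.notMem_support.mp fun h ↦ ht (support_deriv_subset h)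
  have hβ_one : ∀ t ∈ tsupport u, windowBump n t = 1 := fun t ht ↦ by
    have h := hn ht
    exact windowBump_eq_one (abs_le.mpr ⟨by linarith [h.1], by linarith [h.2]⟩)
  have hβ'_zero : ∀ t ∈ tsupport u, deriv (windowBump n) t = 0 := fun t ht ↦ by
    have h := hn ht
    exact deriv_windowBump_eq_zero_of_lt (abs_lt.mpr ⟨by linarith [h.1], by linarith [h.2]⟩)
  have key1 : ∀ t, u t * windowBump n t = u t := fun t ↦ by
    by_cases ht : t ∈ tsupport u
    · rw [hβ_one t ht, mul_one]
    · rw [hu_zero t ht, zero_mul]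
  have key2 : ∀ t, deriv u t * windowBump n t + u t * deriv (windowBump n) t = deriv u t :=
    fun t ↦ by
    by_cases ht : t ∈ tsupport u
    · rw [hβ_one t ht, hβ'_zero t ht]; ring
    · rw [hu_zero t ht, hdu_zero t ht]; ring
  have huR : u (-R) = 0 := hu_zero _ fun h ↦ by have := (hn h).1; linarith
  obtain ⟨C, hC0, hC⟩ := exists_bound_deriv_windowBump n
  have hC2 : (0 : ℝ) < C + 2 := by linarith
  refine ⟨R, hRpos, hsub, fun ε hε ↦ ?_⟩
  set η : ℝ := ε / (C + 2) with hη
  have hηpos : 0 < η := div_pos hε hC2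
  have hηε : η ≤ ε := div_le_self hε.le (by linarith)
  have hηC : η * 1 + η * C ≤ ε := by
    have : η * (C + 2) = ε := by rw [hη, div_mul_cancel₀ ε hC2.ne']
    linarith
  obtain ⟨N, P, hN, hP⟩ := exists_int_polynomial_C1_near hud hudc hRpos huR hηpos
  set q : ℝ → ℝ := fun s ↦ (N : ℝ)⁻¹ * (P.map (Int.castRingHom ℝ)).eval s with hq
  set q' : ℝ → ℝ := fun s ↦ (N : ℝ)⁻¹ * (derivative (P.map (Int.castRingHom ℝ))).eval s
    with hq'
  have hcomb : testCombination monomialBump (polyCombination n P) =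
      fun s ↦ (P.map (Int.castRingHom ℝ)).eval s * windowBump n s :=
    funext fun s ↦ testCombination_polyCombination n P s
  have hv : (fun s ↦ (N : ℝ)⁻¹ * testCombination monomialBump (polyCombination n P) s) =
      fun s ↦ q s * windowBump n s := by
    funext s; rw [testCombination_polyCombination]; simp only [hq]; ring
  have hvd : ∀ t, HasDerivAt (fun s ↦ q s * windowBump n s)
      (q' t * windowBump n t + q t * deriv (windowBump n) t) t := fun t ↦ by
    have h1 : HasDerivAt q (q' t) t := by
      simpa [hq, hq'] using ((P.map (Int.castRingHom ℝ)).hasDerivAt t).const_mul ((N : ℝ)⁻¹)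
    exact h1.mul (differentiable_windowBump n t).hasDerivAt
  refine ⟨N, polyCombination n P, hN, ?_, fun t ↦ ?_, fun t ↦ ?_⟩
  · rw [hcomb]
    exact tsupport_mul_subset_right.trans (tsupport_windowBump n).le
  · have e : u t - (N : ℝ)⁻¹ * testCombination monomialBump (polyCombination n P) t =
        (u t - q t) * windowBump n t := by
      rw [show (N : ℝ)⁻¹ * testCombination monomialBump (polyCombination n P) t =
        q t * windowBump n t from congrFun hv t, sub_mul, key1 t]
    rw [e, abs_mul]
    by_cases ht : t ∈ Icc (-R) R
    · calc |u t - q t| * |windowBump n t| ≤ η * 1 :=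
            mul_le_mul (hP t ht).1 (abs_windowBump_le_one n t) (abs_nonneg _) hηpos.le
        _ ≤ ε := by linarith
    · rw [windowBump_eq_zero ht, abs_zero, mul_zero]
      exact hε.le
  · rw [hv, (hvd t).deriv]
    have e : deriv u t - (q' t * windowBump n t + q t * deriv (windowBump n) t) =
        (deriv u t - q' t) * windowBump n t + (u t - q t) * deriv (windowBump n) t := by
      linear_combination - key2 t
    rw [e]
    by_cases ht : t ∈ Icc (-R) R
    · calc |(deriv u t - q' t) * windowBump n t + (u t - q t) * deriv (windowBump n) t|
            ≤ |(deriv u t - q' t) * windowBump n t| + |(u t - q t) * deriv (windowBump n) t| :=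
            abs_add_le _ _
        _ = |deriv u t - q' t| * |windowBump n t| + |u t - q t| * |deriv (windowBump n) t| := by
            rw [abs_mul, abs_mul]
        _ ≤ η * 1 + η * C :=
            add_le_add
              (mul_le_mul (hP t ht).2 (abs_windowBump_le_one n t) (abs_nonneg _) hηpos.le)
              (mul_le_mul (hP t ht).1 (hC t) (abs_nonneg _) hηpos.le)
        _ ≤ ε := hηC
    · rw [windowBump_eq_zero ht, deriv_windowBump_eq_zero_of_notMem ht]
      simp [hε.le]

end ForcingUp

open ForcingUp in
/-- **The monomial–bump generating family** `φ_{(n,k)}(t) = t^k β_n(t)`, `(n, k) ∈ ℕ × ℕ` — an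
EXPLICIT COUNTABLE generating family with the forcing (density) property PROVED
(`monomialBump_dense`).  Its finite truncation levels `{(n, k) : k ≤ K}` are the levels of the
carrier search; with it, the generating-family component of `ArithmeticWeilSurface` is
non-vacuous by an explicit witness. -/
def monomialBumpFamily : GeneratingFamily where
  ι := ℕ × ℕ
  φ := monomialBump
  isWeilTest := isWeilTest_monomialBump
  dense := monomialBump_dense

/-- The generators of `monomialBumpFamily` are the functions `t ↦ t^k β_n(t)`. -/
theorem monomialBumpFamily_φ (i : ℕ × ℕ) (t : ℝ) :
    monomialBumpFamily.φ i t = t ^ i.2 * windowBump i.1 t := rfl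

/-- **Non-vacuity of the forcing axiom**: generating families exist (witness: the explicit
countable monomial–bump family).  Hence the `gen` component of `ArithmeticWeilSurface` excludes
nothing by itself; whether the remaining (lattice, prime-side data, Hodge-index) fields are
jointly satisfiable is the located gap and is NOT claimed here. -/
theorem nonempty_generatingFamily : Nonempty GeneratingFamily := ⟨monomialBumpFamily⟩

end Summit.RiemannHypothesis.RiemannHypothesis.Theorems.MotivicDoor.AWS
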